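import Literature.NumberTheory.Sieve.PolymathGEHDepol
import Literature.NumberTheory.Sieve.PolymathGEHIdentities
import HarnessLib

/-!
# Slice integrals and the peeling form of the truncated constant (§4.5, p. 18)

Trunk AntSieve, tooling toward the named fact `Literature.NumberTheory.Sieve.weakDHL_three_two_of_GEH`
(D. H. J. Polymath, Res. Math. Sci. 1:12 (2014) = arXiv:1407.4897, Theorem 3.2(xii)).

§4.5, p. 18: the constant `c''_ε` of the truncated inner sum is a sum over `r` of integrals over the
slices `{ε ≤ t_1, …, t_r, t_1 + ⋯ + t_r = 1}` of `∂_{(t_1)}⋯∂_{(t_r)}F(0) ∂_{(t_1)}⋯∂_{(t_r)}G(0)`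
against `dt/(t_1⋯t_r)`, "where we lift Lebesgue measure up to the hyperplane".  This file provides
the continuous-side bookkeeping linking such slice integrals with the recursive quantities `Mfun`
of `PolymathGEHDepol.lean`:

* `sliceInt n t Φ = ∫_{y ∈ ℝ^n} Φ(y, t - Σ y)` — the integral over the hyperplane `Σ = t` in
  `n + 1` variables, and its peeling `sliceInt_succ` (Fubini in the first variable);
* `peelWeight u = 1/∏_i (Σ_{j ≥ i} u_j)` — the symmetrised weights of Lemma 4.4, and
  `Pfun ε n t F = sliceInt n t (1_{u ≥ ε} (∂_{(u)}F(0))² · peelWeight)`;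
* `Pfun_eq_Mfun` — `Pfun ε n t F = Depol.Mfun ε n t F`.

## References

* [Polymath8b2014] D. H. J. Polymath, Res. Math. Sci. 1 (2014), Art. 12 = arXiv:1407.4897,
  §4.5, p. 18 and Lemma 4.4.
-/

noncomputable section

open MeasureTheory Set Filter Finset intervalIntegral
open scoped Topology Interval BigOperators

namespace Literature.NumberTheory.Sieve

namespace Depol

/-! ### Differences commute -/

/-- `∂_{(a)} ∂_{(b)} = ∂_{(b)} ∂_{(a)}`. [folklore] -/
theorem fdiff_comm (a b : ℝ) (F : ℝ → ℝ) : fdiff a (fdiff b F) = fdiff b (fdiff a F) := by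
  funext u; simp [fdiff]; ring_nf

/-- Iterated differences commute with a further difference. [folklore] -/
theorem dIterV_fdiff (a : ℝ) (F : ℝ → ℝ) :
    ∀ (j : ℕ) (s : Fin j → ℝ), dIterV j s (fdiff a F) = fdiff a (dIterV j s F)
  | 0, s => rfl
  | j + 1, s => by rw [dIterV_succ, dIterV_succ, dIterV_fdiff a F j, fdiff_comm]

/-! ### Slice integrals -/

/-- The slice integral `∫_{y ∈ ℝ^n} Φ(y₀, …, y_{n-1}, t - Σ yᵢ) dy` over the hyperplane `Σ u = t`
in `n + 1` variables ("lift Lebesgue measure up to the hyperplane", p. 18). [cite: Polymath8b2014, §4.5, p. 18] -/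
def sliceInt (n : ℕ) (t : ℝ) (Φ : (Fin (n + 1) → ℝ) → ℝ) : ℝ :=
  ∫ y : Fin n → ℝ, Φ (Fin.snoc y (t - ∑ i, y i))

/-- The slice map `y ↦ (y, t - Σ y)`. [folklore] -/
def sliceMap (n : ℕ) (t : ℝ) (y : Fin n → ℝ) : Fin (n + 1) → ℝ := Fin.snoc y (t - ∑ i, y i)

/-- The coordinates of the slice map sum to `t`. [folklore] -/
theorem sum_sliceMap (n : ℕ) (t : ℝ) (y : Fin n → ℝ) : ∑ i, sliceMap n t y i = t := by
  rw [sliceMap, Fin.sum_univ_castSucc]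
  simp only [Fin.snoc_castSucc, Fin.snoc_last]
  ring

/-- The slice map is continuous. [folklore] -/
theorem continuous_sliceMap (n : ℕ) : Continuous (fun p : ℝ × (Fin n → ℝ) => sliceMap n p.1 p.2) := by
  refine continuous_pi fun i => ?_
  refine Fin.lastCases ?_ (fun i => ?_) i
  · simp only [sliceMap, Fin.snoc_last]
    exact continuous_fst.sub (continuous_finsetSum _ fun i _ => (continuous_apply i).comp continuous_snd)
  · simp only [sliceMap, Fin.snoc_castSucc]
    exact (continuous_apply i).comp continuous_snd

/-- The slice integral in `0 + 1` variables is an evaluation. [folklore] -/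
theorem sliceInt_zero (t : ℝ) (Φ : (Fin 1 → ℝ) → ℝ) : sliceInt 0 t Φ = Φ (fun _ => t) := by
  rw [sliceInt, Measure.volume_pi_eq_dirac (default : Fin 0 → ℝ), integral_dirac]
  congr 1
  funext i
  rw [Fin.fin_one_eq_zero i]
  simp [Fin.snoc]

/-- **Peeling a slice integral**: for `Φ` such that `y ↦ Φ(y, t - Σy)` is integrable on `ℝ^{n+1}`,
`sliceInt (n+1) t Φ = ∫_a sliceInt n (t - a) (Φ(a, ·)) da`. [folklore] -/
theorem sliceInt_succ (n : ℕ) (t : ℝ) (Φ : (Fin (n + 2) → ℝ) → ℝ)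
    (hint : Integrable (fun y : Fin (n + 1) → ℝ => Φ (sliceMap (n + 1) t y))) :
    sliceInt (n + 1) t Φ = ∫ a : ℝ, sliceInt n (t - a) (fun z => Φ (Fin.cons a z)) := by
  rw [sliceInt]
  set e := MeasurableEquiv.piFinSuccAbove (fun _ : Fin (n + 1) => ℝ) 0 with he
  have hmp : MeasurePreserving e volume volume := volume_preserving_piFinSuccAbove (fun _ : Fin (n + 1) => ℝ) 0
  have hsymm : ∀ p : ℝ × (Fin n → ℝ), e.symm p = Fin.cons p.1 p.2 := by
    intro p
    rw [he, MeasurableEquiv.piFinSuccAbove_symm_apply, Fin.insertNthEquiv_zero]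
    rfl
  -- transport the integral to the product
  have h1 : ∫ y : Fin (n + 1) → ℝ, Φ (Fin.snoc y (t - ∑ i, y i)) =
      ∫ p : ℝ × (Fin n → ℝ), Φ (Fin.snoc (e.symm p) (t - ∑ i, (e.symm p) i)) := by
    rw [← hmp.symm.integral_comp' (g := fun y : Fin (n + 1) → ℝ => Φ (Fin.snoc y (t - ∑ i, y i)))]
  rw [h1]
  have hint' : Integrable (fun p : ℝ × (Fin n → ℝ) => Φ (Fin.snoc (e.symm p) (t - ∑ i, (e.symm p) i)))
      (volume.prod volume) := by
    have := (hmp.symm.integrable_comp_emb e.symm.measurableEmbedding).2 hint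
    exact this
  rw [Measure.volume_eq_prod, integral_prod _ hint']
  refine integral_congr_ae (Eventually.of_forall fun a => ?_)
  simp only [hsymm, sliceInt]
  refine integral_congr_ae (Eventually.of_forall fun z => ?_)
  simp only [Fin.sum_cons]
  rw [← Fin.cons_snoc_eq_snoc_cons]
  congr 2
  ring

/-! ### The peeling weights and the truncated slice constants -/

/-- The weights `1/∏_i (Σ_{j ≥ i} u_j)` of the symmetrised form of Lemma 4.4
(`= 1/(t (t - u₀) (t - u₀ - u₁) ⋯)` on the slice `Σ u = t`). [cite: Polymath8b2014, Lemma 4.4] -/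
def peelWeight {r : ℕ} (u : Fin r → ℝ) : ℝ := (∏ i : Fin r, ∑ j ∈ Finset.Ici i, u j)⁻¹

/-- `(∂_{(u₀)}⋯∂_{(u_{r-1})} F(0))²`. [cite: Polymath8b2014, §4.5, p. 18] -/
def sqIter (F : ℝ → ℝ) {r : ℕ} (u : Fin r → ℝ) : ℝ := (dIterV r u F 0) ^ 2

/-- The truncated integrand `1_{u ≥ ε} (∂_{(u)}F(0))² · peelWeight u`. [cite: Polymath8b2014, §4.5, p. 18] -/
def roughIntegrand (ε : ℝ) (F : ℝ → ℝ) {r : ℕ} (u : Fin r → ℝ) : ℝ :=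
  if ∀ i, ε ≤ u i then sqIter F u * peelWeight u else 0

/-- The slice constant `P_n(t) = ∫_{Σ u = t} 1_{u ≥ ε} (∂_{(u)}F(0))² peelWeight(u) dσ`
(`n + 1` variables). [cite: Polymath8b2014, §4.5, p. 18] -/
def Pfun (ε : ℝ) (n : ℕ) (t : ℝ) (F : ℝ → ℝ) : ℝ := sliceInt n t (roughIntegrand ε F)

/-- Tail sums of a `cons`: `Σ_{j ≥ succ i} (cons a z)_j = Σ_{j ≥ i} z_j`. [folklore] -/
theorem sum_Ici_cons_succ {m : ℕ} (a : ℝ) (z : Fin m → ℝ) (i : Fin m) :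
    ∑ j ∈ Finset.Ici i.succ, (Fin.cons a z : Fin (m + 1) → ℝ) j = ∑ j ∈ Finset.Ici i, z j := by
  rw [← Fin.map_succEmb_Ici, Finset.sum_map]
  rfl

/-- `Σ_{j ≥ 0} v_j = Σ_j v_j` on `Fin (m+1)`. [folklore] -/
theorem sum_Ici_zero_eq {m : ℕ} (v : Fin (m + 1) → ℝ) : ∑ j ∈ Finset.Ici (0 : Fin (m + 1)), v j = ∑ j, v j := by
  rw [Finset.eq_univ_of_forall (s := Finset.Ici (0 : Fin (m + 1))) fun j => Finset.mem_Ici.2 (Fin.zero_le j)]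

/-- **Peeling the weight**: `peelWeight (cons a z) = (a + Σ z)⁻¹ · peelWeight z`. [cite: Polymath8b2014, Lemma 4.4] -/
theorem peelWeight_cons {m : ℕ} (a : ℝ) (z : Fin m → ℝ) :
    peelWeight (Fin.cons a z : Fin (m + 1) → ℝ) = (a + ∑ i, z i)⁻¹ * peelWeight z := by
  rw [peelWeight, peelWeight, Fin.prod_univ_succ, sum_Ici_zero_eq, Fin.sum_cons, mul_inv]
  congr 2
  exact Finset.prod_congr rfl fun i _ => sum_Ici_cons_succ a z i

/-- **Peeling the square**: `sqIter F (cons a z) = sqIter (∂_{(a)}F) z`. [folklore] -/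
theorem sqIter_cons {m : ℕ} (F : ℝ → ℝ) (a : ℝ) (z : Fin m → ℝ) :
    sqIter F (Fin.cons a z : Fin (m + 1) → ℝ) = sqIter (fdiff a F) z := by
  rw [sqIter, sqIter, dIterV_cons, dIterV_fdiff]

/-- **Peeling the truncated integrand** on the slice `a + Σ z = t`:
`roughIntegrand ε F (cons a z) = [ε ≤ a] t⁻¹ roughIntegrand ε (∂_{(a)}F) z`. [cite: Polymath8b2014, §4.5, p. 18] -/
theorem roughIntegrand_cons {m : ℕ} (ε : ℝ) (F : ℝ → ℝ) (a : ℝ) (z : Fin m → ℝ) {t : ℝ} (ht : a + ∑ i, z i = t) :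
    roughIntegrand ε F (Fin.cons a z : Fin (m + 1) → ℝ) =
      (if ε ≤ a then t⁻¹ * roughIntegrand ε (fdiff a F) z else 0) := by
  simp only [roughIntegrand, Fin.forall_fin_succ, Fin.cons_zero, Fin.cons_succ]
  by_cases ha : ε ≤ a
  · rw [if_pos ha]
    by_cases hz : ∀ i, ε ≤ z i
    · rw [if_pos ⟨ha, hz⟩, if_pos hz, sqIter_cons, peelWeight_cons, ht]; ring
    · rw [if_neg (fun h => hz h.2), if_neg hz, mul_zero]
  · rw [if_neg (fun h => ha h.1), if_neg ha]

/-! ### Regularity of the truncated integrand -/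

/-- `|∂_{(s₀)}⋯F(0)| ≤ 2^j D |s₀|` (one difference of size `|s₀|`, the rest bounded by `2`). [folklore] -/
theorem abs_dIterV_zero_le {F : ℝ → ℝ} {D : ℝ} (hF : NiceFun F D) {j : ℕ} (s : Fin (j + 1) → ℝ) :
    |dIterV (j + 1) s F 0| ≤ 2 ^ j * D * |s 0| := by
  rw [dIterV_succ, fdiff_apply, zero_add]
  have h := (niceFun_dIterV hF j (Fin.tail s)).abs_sub_le (s 0) 0
  rwa [sub_zero] at h

/-- The tail sums are `≥ ε` and the weight is `≤ ε^{-r}` on `{u ≥ ε}`. [folklore] -/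
theorem peelWeight_le {r : ℕ} {ε : ℝ} (hε : 0 < ε) {u : Fin r → ℝ} (hu : ∀ i, ε ≤ u i) :
    0 ≤ peelWeight u ∧ peelWeight u ≤ (ε ^ r)⁻¹ := by
  have htail : ∀ i : Fin r, ε ≤ ∑ j ∈ Finset.Ici i, u j := fun i =>
    calc ε ≤ u i := hu i
      _ ≤ ∑ j ∈ Finset.Ici i, u j :=
          Finset.single_le_sum (f := u) (fun j _ => hε.le.trans (hu j)) (Finset.mem_Ici.2 le_rfl)
  have hprod : ε ^ r ≤ ∏ i : Fin r, ∑ j ∈ Finset.Ici i, u j := by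
    calc ε ^ r = ∏ _i : Fin r, ε := by rw [Finset.prod_const, Finset.card_univ, Fintype.card_fin]
      _ ≤ _ := Finset.prod_le_prod (fun i _ => hε.le) fun i _ => htail i
  have hpos : 0 < ∏ i : Fin r, ∑ j ∈ Finset.Ici i, u j := lt_of_lt_of_le (pow_pos hε r) hprod
  rw [peelWeight]
  exact ⟨inv_nonneg.2 hpos.le, (inv_le_inv₀ hpos (pow_pos hε r)).2 hprod⟩

/-- Measurability of the truncated integrand. [folklore] -/
theorem measurable_roughIntegrand (ε : ℝ) {F : ℝ → ℝ} (hF : Continuous F) (r : ℕ) :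
    Measurable (roughIntegrand ε F : (Fin r → ℝ) → ℝ) := by
  have h1 : Measurable fun u : Fin r → ℝ => sqIter F u * peelWeight u := by
    refine Measurable.mul ?_ ?_
    · exact (((continuous_dIterV hF r).comp (continuous_id.prodMk continuous_const)).pow 2).measurable
    · exact (continuous_finsetProd _ fun i _ => continuous_finsetSum _ fun j _ => continuous_apply j).measurable.inv
  have hset : MeasurableSet {u : Fin r → ℝ | ∀ i, ε ≤ u i} := by
    have : {u : Fin r → ℝ | ∀ i, ε ≤ u i} = ⋂ i, {u | ε ≤ u i} := by ext u; simp
    rw [this]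
    exact MeasurableSet.iInter fun i => measurableSet_le measurable_const (measurable_pi_apply i)
  have : (roughIntegrand ε F : (Fin r → ℝ) → ℝ) = {u | ∀ i, ε ≤ u i}.indicator fun u => sqIter F u * peelWeight u := by
    funext u; rw [roughIntegrand, Set.indicator_apply]; rfl
  rw [this]
  exact h1.indicator hset

/-- Bound for the truncated integrand in `n + 1` variables: `|·| ≤ (2^n D |u₀|)² ε^{-(n+1)}`. [folklore] -/
theorem abs_roughIntegrand_le {ε : ℝ} (hε : 0 < ε) {F : ℝ → ℝ} {D : ℝ} (hF : NiceFun F D) {n : ℕ}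
    (u : Fin (n + 1) → ℝ) : |roughIntegrand ε F u| ≤ (2 ^ n * D * |u 0|) ^ 2 * (ε ^ (n + 1))⁻¹ := by
  rw [roughIntegrand]
  split_ifs with hu
  · obtain ⟨hw0, hw⟩ := peelWeight_le hε hu
    rw [abs_mul, abs_of_nonneg hw0, sqIter, abs_of_nonneg (sq_nonneg _)]
    refine mul_le_mul ?_ hw hw0 (by positivity)
    rw [← sq_abs]
    exact pow_le_pow_left₀ (abs_nonneg _) (abs_dIterV_zero_le hF u) 2
  · rw [abs_zero]; positivity

/-- The slice of the support is bounded: if `roughIntegrand ε F (sliceMap (n+1) t y) ≠ 0` then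
`y ∈ [ε, t]^{n+1}`. [folklore] -/
theorem mem_Icc_of_roughIntegrand_sliceMap_ne_zero {ε : ℝ} (hε : 0 < ε) (F : ℝ → ℝ) {n : ℕ} {t : ℝ}
    {y : Fin (n + 1) → ℝ} (h : roughIntegrand ε F (sliceMap (n + 1) t y) ≠ 0) :
    y ∈ Set.Icc (fun _ : Fin (n + 1) => ε) (fun _ => t) := by
  rw [roughIntegrand] at h
  split_ifs at h with hu
  · have hy : ∀ i : Fin (n + 1), ε ≤ y i := fun i => by
      have := hu i.castSucc; rwa [sliceMap, Fin.snoc_castSucc] at this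
    have hlast : ε ≤ t - ∑ i, y i := by have := hu (Fin.last _); rwa [sliceMap, Fin.snoc_last] at this
    refine ⟨fun i => hy i, fun i => ?_⟩
    have : y i ≤ ∑ j, y j := Finset.single_le_sum (f := y) (fun j _ => hε.le.trans (hy j)) (Finset.mem_univ i)
    simp only
    linarith
  · exact absurd rfl h

/-- **Integrability of the truncated integrand on a slice** (`n + 2` variables, slice parametrised by
`ℝ^{n+1}`). [folklore] -/
theorem integrable_roughIntegrand_sliceMap {ε : ℝ} (hε : 0 < ε) {F : ℝ → ℝ} {D : ℝ} (hF : NiceFun F D)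
    (n : ℕ) (t : ℝ) : Integrable (fun y : Fin (n + 1) → ℝ => roughIntegrand ε F (sliceMap (n + 1) t y)) := by
  set K : Set (Fin (n + 1) → ℝ) := Set.Icc (fun _ => ε) (fun _ => t) with hK
  have hKm : MeasurableSet K := measurableSet_Icc
  have hKvol : volume K < ⊤ := by
    rw [hK, Real.volume_Icc_pi]; exact ENNReal.prod_lt_top fun i _ => ENNReal.ofReal_lt_top
  set f : (Fin (n + 1) → ℝ) → ℝ := fun y => roughIntegrand ε F (sliceMap (n + 1) t y) with hf
  have hmeas : Measurable f :=
    (measurable_roughIntegrand ε hF.continuous (n + 2)).comp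
      ((continuous_sliceMap (n + 1)).comp (continuous_const.prodMk continuous_id)).measurable
  have hsupp : f = K.indicator f := by
    funext y
    by_cases hy : y ∈ K
    · rw [Set.indicator_of_mem hy]
    · rw [Set.indicator_of_notMem hy]
      by_contra h
      exact hy (mem_Icc_of_roughIntegrand_sliceMap_ne_zero hε F h)
  rw [hsupp, integrable_indicator_iff hKm]
  refine IntegrableOn.of_bound hKvol hmeas.aestronglyMeasurable ((2 ^ (n + 1) * D * max |ε| |t|) ^ 2 * (ε ^ (n + 2))⁻¹) ?_
  rw [ae_restrict_iff' hKm]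
  refine Eventually.of_forall fun y hy => ?_
  rw [Real.norm_eq_abs, hf]
  refine (abs_roughIntegrand_le hε hF _).trans ?_
  have h0 : |sliceMap (n + 1) t y 0| ≤ max |ε| |t| := by
    rw [sliceMap, show (0 : Fin (n + 2)) = (0 : Fin (n + 1)).castSucc from rfl, Fin.snoc_castSucc]
    have h1 : ε ≤ y 0 := hy.1 0
    have h2 : y 0 ≤ t := hy.2 0
    rw [abs_le]
    constructor
    · have := neg_abs_le ε; linarith [le_max_left |ε| |t|, le_abs_self ε]
    · exact h2.trans ((le_abs_self t).trans (le_max_right _ _))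
  have hD := hF.nonneg
  gcongr

/-! ### `Pfun = Mfun` -/

/-- `Mfun ε n b G = 0` for `b < ε` (`ε > 0`). [folklore] -/
theorem Mfun_eq_zero_of_lt {ε : ℝ} (hε : 0 < ε) : ∀ (n : ℕ) {b : ℝ}, b < ε → ∀ G : ℝ → ℝ, Mfun ε n b G = 0
  | 0, b, hb, G => by rw [Mfun_zero]; simp only; rw [if_neg (not_le.2 hb)]
  | 1, b, hb, G => by
    rw [Mfun_one]; simp only
    rw [max_eq_left (by linarith), intervalIntegral.integral_same, zero_div]
  | n + 2, b, hb, G => by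
    rw [Mfun_succ_succ, peelT, max_eq_left hb.le, intervalIntegral.integral_same, zero_div]

/-- The base case `Pfun ε 0 t F = Mfun ε 0 t F`. [cite: Polymath8b2014, §4.5, p. 18] -/
theorem Pfun_zero (ε t : ℝ) (F : ℝ → ℝ) : Pfun ε 0 t F = Mfun ε 0 t F := by
  rw [Pfun, sliceInt_zero, roughIntegrand, Mfun_zero]
  simp only [forall_const]
  split_ifs with h
  · rw [sqIter, peelWeight, dIterV_succ, dIterV_zero, fdiff_apply, zero_add, Jfun,
      Fin.prod_univ_one, sum_Ici_zero_eq, Fin.sum_univ_one, div_eq_mul_inv]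
  · rfl

/-- **The slice constants are the recursive truncated constants**: `Pfun ε n t F = Mfun ε n t F`
for `ε > 0` and nice `F`. [cite: Polymath8b2014, §4.5, p. 18] -/
theorem Pfun_eq_Mfun {ε : ℝ} (hε : 0 < ε) :
    ∀ (n : ℕ) {F : ℝ → ℝ} {D : ℝ}, NiceFun F D → ∀ t : ℝ, Pfun ε n t F = Mfun ε n t F
  | 0, F, D, _, t => Pfun_zero ε t F
  | n + 1, F, D, hF, t => by
    rw [Pfun, sliceInt_succ n t _ (integrable_roughIntegrand_sliceMap hε hF n t)]
    -- peel the first variable on each slice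
    have hslice : ∀ a, sliceInt n (t - a) (fun z => roughIntegrand ε F (Fin.cons a z)) =
        (Set.Ici ε).indicator (fun a => t⁻¹ * Mfun ε n (t - a) (fdiff a F)) a := by
      intro a
      simp only [sliceInt, Set.indicator_apply, Set.mem_Ici]
      have hpt : ∀ y : Fin n → ℝ, roughIntegrand ε F (Fin.cons a (Fin.snoc y (t - a - ∑ i, y i))) =
          (if ε ≤ a then t⁻¹ * roughIntegrand ε (fdiff a F) (Fin.snoc y (t - a - ∑ i, y i)) else 0) := by
        intro y
        refine roughIntegrand_cons ε F a _ ?_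
        have := sum_sliceMap n (t - a) y
        rw [sliceMap] at this
        linarith
      simp_rw [hpt]
      split_ifs with ha
      · rw [MeasureTheory.integral_const_mul, ← Pfun_eq_Mfun hε n (hF.fdiff a) (t - a), Pfun, sliceInt]
      · simp
    simp_rw [hslice]
    rw [MeasureTheory.integral_indicator measurableSet_Ici, MeasureTheory.integral_const_mul]
    -- the set integral over `[ε, ∞)` is the interval integral over `[ε, max ε t]`
    set T := max ε t with hT
    have hvanish : ∀ a, T < a → Mfun ε n (t - a) (fdiff a F) = 0 := fun a ha =>
      Mfun_eq_zero_of_lt hε n (by have := le_max_right ε t; linarith) _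
    have h1 : ∫ a in Set.Ici ε, Mfun ε n (t - a) (fdiff a F) = ∫ a in Set.Icc ε T, Mfun ε n (t - a) (fdiff a F) := by
      have e1 : ∫ a in Set.Ici ε, Mfun ε n (t - a) (fdiff a F) =
          ∫ a in Set.Ici ε, (Set.Iic T).indicator (fun a => Mfun ε n (t - a) (fdiff a F)) a :=
        setIntegral_congr_fun measurableSet_Ici fun a _ => by
          simp only [Set.indicator_apply, Set.mem_Iic]
          split_ifs with ha
          · rfl
          · exact hvanish a (not_le.1 ha)
      rw [e1, setIntegral_indicator measurableSet_Iic, Set.Ici_inter_Iic]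
    rw [h1, integral_Icc_eq_integral_Ioc, ← intervalIntegral.integral_of_le (le_max_left ε t),
      Mfun_succ_eq_peelT hε hF t n, peelT]
    rcases eq_or_ne t 0 with rfl | ht
    · simp
    · field_simp

/-! ### The closed form of the iterated difference and its symmetry -/

/-- The alternating subset sum `Σ_{S ⊆ [r]} (-1)^{|S|} F(v + Σ_{i ∈ S} u_i)`. [cite: Polymath8b2014, §4.5, p. 17] -/
def altSum (F : ℝ → ℝ) (r : ℕ) (u : Fin r → ℝ) (v : ℝ) : ℝ :=
  ∑ S : Finset (Fin r), (-1 : ℝ) ^ S.card * F (v + ∑ i ∈ S, u i)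

/-- **Closed form**: `∂_{(u₀)}⋯∂_{(u_{r-1})}F(v) = (-1)^r Σ_{S ⊆ [r]} (-1)^{|S|} F(v + Σ_{i∈S} u_i)`. [cite: Polymath8b2014, §4.5, p. 17] -/
theorem dIterV_eq_altSum (F : ℝ → ℝ) : ∀ (r : ℕ) (u : Fin r → ℝ) (v : ℝ),
    dIterV r u F v = (-1 : ℝ) ^ r * altSum F r u v
  | 0, u, v => by
    rw [altSum, Finset.sum_eq_single_of_mem (∅ : Finset (Fin 0)) (Finset.mem_univ _)
      (fun S _ hS => absurd (Finset.eq_empty_of_isEmpty S) hS)]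
    simp
  | r + 1, u, v => by
    rw [dIterV_succ, fdiff_apply, dIterV_eq_altSum F r (Fin.tail u) (v + u 0), dIterV_eq_altSum F r (Fin.tail u) v]
    -- split the subsets of `Fin (r+1)` according to `0 ∈ S`
    have hsplit : altSum F (r + 1) u v =
        ∑ T : Finset (Fin r), (-1 : ℝ) ^ T.card * F (v + ∑ i ∈ T, Fin.tail u i) -
          ∑ T : Finset (Fin r), (-1 : ℝ) ^ T.card * F (v + u 0 + ∑ i ∈ T, Fin.tail u i) := by
      rw [altSum, ← Finset.powerset_univ, Fin.univ_succ, Finset.cons_eq_insert,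
        Finset.sum_powerset_insert (by simp), ← Finset.powerset_univ]
      set e : Fin r ↪ Fin (r + 1) := ⟨Fin.succ, Fin.succ_injective _⟩ with he
      have hmap : (Finset.univ : Finset (Fin r)).map e = (Finset.univ : Finset (Fin r)).image Fin.succ :=
        Finset.map_eq_image e _
      have hinj : Set.InjOn (fun T : Finset (Fin r) => T.image Fin.succ) ↑(Finset.univ : Finset (Fin r)).powerset :=
        fun T _ T' _ h => Finset.image_injective (Fin.succ_injective _) h
      rw [hmap, Finset.powerset_image, Finset.sum_image hinj, Finset.sum_image hinj, Finset.powerset_univ]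
      have h1 : ∀ T : Finset (Fin r), (-1 : ℝ) ^ (T.image Fin.succ).card * F (v + ∑ i ∈ T.image Fin.succ, u i) =
          (-1 : ℝ) ^ T.card * F (v + ∑ i ∈ T, Fin.tail u i) := by
        intro T
        rw [Finset.card_image_of_injective _ (Fin.succ_injective _), Finset.sum_image fun i _ j _ h => Fin.succ_injective _ h]
        rfl
      have h2 : ∀ T : Finset (Fin r), (-1 : ℝ) ^ (insert (0 : Fin (r + 1)) (T.image Fin.succ)).card *
          F (v + ∑ i ∈ insert (0 : Fin (r + 1)) (T.image Fin.succ), u i) =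
          -((-1 : ℝ) ^ T.card * F (v + u 0 + ∑ i ∈ T, Fin.tail u i)) := by
        intro T
        have h0 : (0 : Fin (r + 1)) ∉ T.image Fin.succ := by simp
        rw [Finset.card_insert_of_notMem h0, Finset.sum_insert h0, Finset.card_image_of_injective _ (Fin.succ_injective _),
          Finset.sum_image fun i _ j _ h => Fin.succ_injective _ h, pow_succ]
        simp only [Fin.tail]
        ring_nf
      simp_rw [h1, h2, Finset.sum_neg_distrib]
      ring
    rw [hsplit, altSum, altSum, pow_succ]
    ring

/-- `altSum` is symmetric under permutations of the variables. [folklore] -/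
theorem altSum_perm (F : ℝ → ℝ) {r : ℕ} (σ : Equiv.Perm (Fin r)) (u : Fin r → ℝ) (v : ℝ) :
    altSum F r (u ∘ σ) v = altSum F r u v := by
  unfold altSum
  -- reindex `S ↦ S.map σ`
  refine Finset.sum_bij (fun S _ => S.map σ.toEmbedding) (fun _ _ => Finset.mem_univ _)
    (fun S _ S' _ h => Finset.map_injective σ.toEmbedding h)
    (fun S _ => ⟨S.map σ.symm.toEmbedding, Finset.mem_univ _, by
      rw [Finset.map_map]; convert Finset.map_refl using 2; ext i; simp⟩)
    fun S _ => ?_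
  rw [Finset.card_map, Finset.sum_map]
  rfl

/-- `sqIter F u = (altSum F r u 0)²`. [folklore] -/
theorem sqIter_eq_altSum_sq (F : ℝ → ℝ) {r : ℕ} (u : Fin r → ℝ) : sqIter F u = (altSum F r u 0) ^ 2 := by
  rw [sqIter, dIterV_eq_altSum, mul_pow, ← pow_mul, mul_comm r 2, pow_mul]
  norm_num

/-- `sqIter` is symmetric under permutations. [folklore] -/
theorem sqIter_perm (F : ℝ → ℝ) {r : ℕ} (σ : Equiv.Perm (Fin r)) (u : Fin r → ℝ) :
    sqIter F (u ∘ σ) = sqIter F u := by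
  rw [sqIter_eq_altSum_sq, sqIter_eq_altSum_sq, altSum_perm]

/-! ### Lemma 4.4 under the integral sign: symmetrisation -/

/-- Composition with a permutation preserves Lebesgue measure on `ℝ^r`. [folklore] -/
theorem measurePreserving_comp_perm {r : ℕ} (σ : Equiv.Perm (Fin r)) :
    MeasurePreserving (fun u : Fin r → ℝ => u ∘ σ) volume volume := by
  have h := volume_measurePreserving_piCongrLeft (fun _ : Fin r => ℝ) σ.symm
  have hfun : ⇑(MeasurableEquiv.piCongrLeft (fun _ : Fin r => ℝ) σ.symm) = fun u : Fin r → ℝ => u ∘ σ := by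
    funext u i
    have := MeasurableEquiv.piCongrLeft_apply_apply σ.symm (β := fun _ : Fin r => ℝ) u (σ i)
    simpa using this
  rwa [hfun] at h

/-- **Symmetrisation** (Lemma 4.4 integrated): for a permutation-invariant `Φ` supported in
`{u > 0}`, `∫ Φ(u)/(u₀⋯u_{r-1}) du = r! ∫ Φ(u) peelWeight(u) du`. [cite: Polymath8b2014, §4.5, p. 18 ("From this lemma and symmetrisation")] -/
theorem integral_symmetrise {r : ℕ} (Φ : (Fin r → ℝ) → ℝ) (hΦ : ∀ (σ : Equiv.Perm (Fin r)) (u : Fin r → ℝ), Φ (u ∘ σ) = Φ u)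
    (hsupp : ∀ u, Φ u ≠ 0 → ∀ i, 0 < u i) (hint : Integrable fun u : Fin r → ℝ => Φ u * peelWeight u) :
    ∫ u : Fin r → ℝ, Φ u * (∏ i, u i)⁻¹ = (Nat.factorial r : ℝ) * ∫ u : Fin r → ℝ, Φ u * peelWeight u := by
  -- pointwise Lemma 4.4
  have hpt : ∀ u : Fin r → ℝ, Φ u * (∏ i, u i)⁻¹ = ∑ σ : Equiv.Perm (Fin r), Φ u * peelWeight (u ∘ σ) := by
    intro u
    by_cases hu : Φ u = 0
    · simp [hu]
    · rw [inv_prod_eq_sum_perm_inv_prod_tailSum r u (hsupp u hu), Finset.mul_sum]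
      rfl
  simp_rw [hpt]
  -- each permuted term has the same integral
  have hterm : ∀ σ : Equiv.Perm (Fin r), Integrable (fun u : Fin r → ℝ => Φ u * peelWeight (u ∘ σ)) ∧
      ∫ u : Fin r → ℝ, Φ u * peelWeight (u ∘ σ) = ∫ u : Fin r → ℝ, Φ u * peelWeight u := by
    intro σ
    have hmp := measurePreserving_comp_perm σ
    have hemb : MeasurableEmbedding (fun u : Fin r → ℝ => u ∘ σ) := by
      have h := (MeasurableEquiv.piCongrLeft (fun _ : Fin r => ℝ) σ.symm).measurableEmbedding
      have hfun : ⇑(MeasurableEquiv.piCongrLeft (fun _ : Fin r => ℝ) σ.symm) = fun u : Fin r → ℝ => u ∘ σ := by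
        funext u i
        have := MeasurableEquiv.piCongrLeft_apply_apply σ.symm (β := fun _ : Fin r => ℝ) u (σ i)
        simpa using this
      rwa [hfun] at h
    have h1 : Integrable ((fun w => Φ w * peelWeight w) ∘ fun u : Fin r → ℝ => u ∘ σ) :=
      (hmp.integrable_comp_emb hemb).2 hint
    have h2 := hmp.integral_comp hemb (fun w => Φ w * peelWeight w)
    refine ⟨?_, ?_⟩
    · have e : (fun u : Fin r → ℝ => Φ u * peelWeight (u ∘ σ)) = ((fun w => Φ w * peelWeight w) ∘ fun u => u ∘ σ) := by
        funext u; simp only [Function.comp_apply, hΦ σ u]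
      rw [e]; exact h1
    · have e2 : ∀ u : Fin r → ℝ, Φ u * peelWeight (u ∘ σ) = Φ (u ∘ σ) * peelWeight (u ∘ σ) := fun u => by rw [hΦ σ u]
      simp_rw [e2]
      simpa using h2
  rw [integral_finsetSum _ fun σ _ => (hterm σ).1]
  simp_rw [fun σ => (hterm σ).2]
  rw [Finset.sum_const, Finset.card_univ, Fintype.card_perm, Fintype.card_fin, nsmul_eq_mul]

/-! ### The coarea formula along `Σ u` -/

/-- The shear `(y, t) ↦ (y, t - Σ y)` as a measurable equivalence. [folklore] -/
def shearEquiv (n : ℕ) : ((Fin n → ℝ) × ℝ) ≃ᵐ ((Fin n → ℝ) × ℝ) where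
  toFun p := (p.1, p.2 - ∑ i, p.1 i)
  invFun p := (p.1, p.2 + ∑ i, p.1 i)
  left_inv p := by simp
  right_inv p := by simp
  measurable_toFun := measurable_fst.prodMk
    (measurable_snd.sub ((Finset.measurable_sum _ fun i _ => measurable_pi_apply i).comp measurable_fst))
  measurable_invFun := measurable_fst.prodMk
    (measurable_snd.add ((Finset.measurable_sum _ fun i _ => measurable_pi_apply i).comp measurable_fst))

/-- The slice parametrisation `(y, t) ↦ (y, t - Σ y)` of `ℝ^{n+1}` as a measurable equivalence. [folklore] -/
def sliceEquiv (n : ℕ) : ((Fin n → ℝ) × ℝ) ≃ᵐ (Fin (n + 1) → ℝ) :=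
  ((shearEquiv n).trans MeasurableEquiv.prodComm).trans
    (MeasurableEquiv.piFinSuccAbove (fun _ : Fin (n + 1) => ℝ) (Fin.last n)).symm

/-- The slice parametrisation is the slice map. [folklore] -/
theorem sliceEquiv_apply (n : ℕ) (p : (Fin n → ℝ) × ℝ) : sliceEquiv n p = sliceMap n p.2 p.1 := by
  simp only [sliceEquiv, MeasurableEquiv.trans_apply, MeasurableEquiv.prodComm, MeasurableEquiv.coe_mk,
    Equiv.prodComm_apply, MeasurableEquiv.piFinSuccAbove_symm_apply, Fin.insertNthEquiv_last, sliceMap]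
  rfl

/-- The slice parametrisation is measure preserving. [folklore] -/
theorem measurePreserving_sliceEquiv (n : ℕ) :
    MeasurePreserving (sliceEquiv n) (volume.prod volume) volume := by
  have hshear : MeasurePreserving (shearEquiv n) (volume.prod volume) (volume.prod volume) := by
    have h := (MeasurePreserving.id (volume : Measure (Fin n → ℝ))).skew_product
      (g := fun (y : Fin n → ℝ) (t : ℝ) => t - ∑ i, y i) (μc := volume) (μd := volume)
      (measurable_snd.sub ((Finset.measurable_sum _ fun i _ => measurable_pi_apply i).comp measurable_fst))
      (Eventually.of_forall fun y => (measurePreserving_sub_right volume (∑ i, y i)).map_eq)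
    exact h
  have hswap : MeasurePreserving (MeasurableEquiv.prodComm : ((Fin n → ℝ) × ℝ) ≃ᵐ (ℝ × (Fin n → ℝ)))
      (volume.prod volume) (volume.prod volume) :=
    Measure.measurePreserving_swap
  have hlast : MeasurePreserving (MeasurableEquiv.piFinSuccAbove (fun _ : Fin (n + 1) => ℝ) (Fin.last n)).symm
      (volume.prod volume) volume :=
    (volume_preserving_piFinSuccAbove (fun _ : Fin (n + 1) => ℝ) (Fin.last n)).symm
  exact hlast.comp (hswap.comp hshear)

/-- **Coarea along `Σ u`**: for integrable `Ψ` on `ℝ^{n+1}`, `∫ Ψ = ∫_t sliceInt n t Ψ dt`. [folklore] -/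
theorem integral_eq_integral_sliceInt (n : ℕ) (Ψ : (Fin (n + 1) → ℝ) → ℝ) (hΨ : Integrable Ψ) :
    ∫ u : Fin (n + 1) → ℝ, Ψ u = ∫ t : ℝ, sliceInt n t Ψ := by
  have hmp := measurePreserving_sliceEquiv n
  rw [← hmp.integral_comp' Ψ]
  have hint : Integrable (fun p : (Fin n → ℝ) × ℝ => Ψ (sliceEquiv n p)) (volume.prod volume) :=
    (hmp.integrable_comp_emb (sliceEquiv n).measurableEmbedding).2 hΨ
  rw [integral_prod_symm _ hint]
  refine integral_congr_ae (Eventually.of_forall fun t => ?_)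
  simp only [sliceEquiv_apply, sliceInt, sliceMap]

/-! ### The main-term integral of §4.5 in peeling form -/

section MainTerm

variable {ε x : ℝ} {F : ℝ → ℝ} {D : ℝ}

/-- The main-term integrand `1_{u ≥ ε, ℓ₁ < Σu ≤ ℓ₂} (∂_{(u)}F(0))² x^{Σu} / (u₀⋯u_{r-1})`
(the comparison integral of the prime-tuple sum, in the variables `uᵢ = log pᵢ / log x`). [cite: Polymath8b2014, §4.5, p. 18] -/
def mainTermIntegrand (ε x : ℝ) (F : ℝ → ℝ) (ℓ₁ ℓ₂ : ℝ) {r : ℕ} (u : Fin r → ℝ) : ℝ :=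
  if (∀ i, ε ≤ u i) ∧ ℓ₁ < ∑ i, u i ∧ ∑ i, u i ≤ ℓ₂ then sqIter F u * x ^ (∑ i, u i) * (∏ i, u i)⁻¹ else 0

/-- The symmetric part `Φ(u) = 1_{…} (∂_{(u)}F(0))² x^{Σu}` of the main-term integrand. [folklore] -/
def mainTermCore (ε x : ℝ) (F : ℝ → ℝ) (ℓ₁ ℓ₂ : ℝ) {r : ℕ} (u : Fin r → ℝ) : ℝ :=
  if (∀ i, ε ≤ u i) ∧ ℓ₁ < ∑ i, u i ∧ ∑ i, u i ≤ ℓ₂ then sqIter F u * x ^ (∑ i, u i) else 0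

/-- The main-term integrand is the core times `1/∏ uᵢ`. [folklore] -/
theorem mainTermIntegrand_eq (ℓ₁ ℓ₂ : ℝ) {r : ℕ} (u : Fin r → ℝ) :
    mainTermIntegrand ε x F ℓ₁ ℓ₂ u = mainTermCore ε x F ℓ₁ ℓ₂ u * (∏ i, u i)⁻¹ := by
  rw [mainTermIntegrand, mainTermCore]; split_ifs <;> simp

/-- The core is permutation invariant. [folklore] -/
theorem mainTermCore_perm (ℓ₁ ℓ₂ : ℝ) {r : ℕ} (σ : Equiv.Perm (Fin r)) (u : Fin r → ℝ) :
    mainTermCore ε x F ℓ₁ ℓ₂ (u ∘ σ) = mainTermCore ε x F ℓ₁ ℓ₂ u := by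
  have hsum : ∑ i, (u ∘ σ) i = ∑ i, u i := Equiv.sum_comp σ u
  have hall : (∀ i, ε ≤ (u ∘ σ) i) ↔ ∀ i, ε ≤ u i :=
    ⟨fun h i => by simpa using h (σ.symm i), fun h i => h (σ i)⟩
  rw [mainTermCore, mainTermCore, hsum, sqIter_perm]
  simp only [hall]

/-- On the slice `Σ u = t` the weighted core is `1_{(ℓ₁,ℓ₂]}(t) x^t roughIntegrand`. [folklore] -/
theorem mainTermCore_mul_peelWeight_of_sum_eq (ℓ₁ ℓ₂ : ℝ) {r : ℕ} {u : Fin r → ℝ} {t : ℝ} (ht : ∑ i, u i = t) :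
    mainTermCore ε x F ℓ₁ ℓ₂ u * peelWeight u =
      (Set.Ioc ℓ₁ ℓ₂).indicator (fun t => x ^ t * roughIntegrand ε F u) t := by
  simp only [mainTermCore, roughIntegrand, ht, Set.indicator_apply, Set.mem_Ioc]
  by_cases h1 : ∀ i, ε ≤ u i
  · by_cases h2 : ℓ₁ < t ∧ t ≤ ℓ₂
    · rw [if_pos ⟨h1, h2⟩, if_pos h2, if_pos h1]; ring
    · rw [if_neg (fun h => h2 h.2), if_neg h2, zero_mul]
  · rw [if_neg (fun h => h1 h.1), if_neg h1, zero_mul]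
    split_ifs <;> simp

/-- The support of the weighted core lies in the box `[ε, ℓ₂]^r` (`ε ≥ 0`). [folklore] -/
theorem mem_Icc_of_mainTermCore_ne_zero (hε : 0 ≤ ε) (ℓ₁ ℓ₂ : ℝ) {r : ℕ} {u : Fin r → ℝ}
    (h : mainTermCore ε x F ℓ₁ ℓ₂ u ≠ 0) : u ∈ Set.Icc (fun _ : Fin r => ε) (fun _ => ℓ₂) ∧
      (∀ i, ε ≤ u i) ∧ ∑ i, u i ≤ ℓ₂ := by
  rw [mainTermCore] at h
  split_ifs at h with hc
  · obtain ⟨h1, -, h3⟩ := hc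
    refine ⟨⟨fun i => h1 i, fun i => ?_⟩, h1, h3⟩
    have : u i ≤ ∑ j, u j := Finset.single_le_sum (f := u) (fun j _ => hε.trans (h1 j)) (Finset.mem_univ i)
    simp only; linarith
  · exact absurd rfl h

/-- **Integrability of the weighted core** on `ℝ^{n+1}` (`0 < ε`, `1 ≤ x`, nice `F`). [folklore] -/
theorem integrable_mainTermCore_mul_peelWeight (hε : 0 < ε) (hx : 1 ≤ x) (hF : NiceFun F D) (ℓ₁ ℓ₂ : ℝ) (n : ℕ) :
    Integrable fun u : Fin (n + 1) → ℝ => mainTermCore ε x F ℓ₁ ℓ₂ u * peelWeight u := by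
  set K : Set (Fin (n + 1) → ℝ) := Set.Icc (fun _ => ε) (fun _ => ℓ₂) with hK
  have hKm : MeasurableSet K := measurableSet_Icc
  have hKvol : volume K < ⊤ := by
    rw [hK, Real.volume_Icc_pi]; exact ENNReal.prod_lt_top fun i _ => ENNReal.ofReal_lt_top
  set f : (Fin (n + 1) → ℝ) → ℝ := fun u => mainTermCore ε x F ℓ₁ ℓ₂ u * peelWeight u with hf
  -- measurability
  have hcond : MeasurableSet {u : Fin (n + 1) → ℝ | (∀ i, ε ≤ u i) ∧ ℓ₁ < ∑ i, u i ∧ ∑ i, u i ≤ ℓ₂} := by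
    have hs : Measurable fun u : Fin (n + 1) → ℝ => ∑ i, u i := Finset.measurable_sum _ fun i _ => measurable_pi_apply i
    have hA : MeasurableSet {u : Fin (n + 1) → ℝ | ∀ i, ε ≤ u i} := by
      have : {u : Fin (n + 1) → ℝ | ∀ i, ε ≤ u i} = ⋂ i, {u | ε ≤ u i} := by ext u; simp
      rw [this]
      exact MeasurableSet.iInter fun i => measurableSet_le measurable_const (measurable_pi_apply i)
    have heq : {u : Fin (n + 1) → ℝ | (∀ i, ε ≤ u i) ∧ ℓ₁ < ∑ i, u i ∧ ∑ i, u i ≤ ℓ₂} =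
        {u | ∀ i, ε ≤ u i} ∩ ({u | ℓ₁ < ∑ i, u i} ∩ {u | ∑ i, u i ≤ ℓ₂}) := by
      ext u; simp only [Set.mem_setOf_eq, Set.mem_inter_iff]
    rw [heq]
    exact hA.inter ((measurableSet_lt measurable_const hs).inter (measurableSet_le hs measurable_const))
  have hmeas : Measurable f := by
    have hsq : Measurable fun u : Fin (n + 1) → ℝ => sqIter F u :=
      (((continuous_dIterV hF.continuous (n + 1)).comp (continuous_id.prodMk continuous_const)).pow 2).measurable
    have hpow : Measurable fun u : Fin (n + 1) → ℝ => x ^ (∑ i, u i) :=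
      (measurable_const.pow (Finset.measurable_sum _ fun i _ => measurable_pi_apply i))
    have hpw : Measurable fun u : Fin (n + 1) → ℝ => peelWeight u :=
      (continuous_finsetProd _ fun i _ => continuous_finsetSum _ fun j _ => continuous_apply j).measurable.inv
    have hcore : Measurable fun u : Fin (n + 1) → ℝ => mainTermCore ε x F ℓ₁ ℓ₂ u := by
      have : (fun u : Fin (n + 1) → ℝ => mainTermCore ε x F ℓ₁ ℓ₂ u) =
          {u | (∀ i, ε ≤ u i) ∧ ℓ₁ < ∑ i, u i ∧ ∑ i, u i ≤ ℓ₂}.indicator fun u => sqIter F u * x ^ (∑ i, u i) := by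
        funext u; rw [mainTermCore, Set.indicator_apply]; rfl
      rw [this]; exact (hsq.mul hpow).indicator hcond
    exact hcore.mul hpw
  -- support and bound
  have hsupp : f = K.indicator f := by
    funext u
    by_cases hu : u ∈ K
    · rw [Set.indicator_of_mem hu]
    · rw [Set.indicator_of_notMem hu]
      by_contra h
      have hne : mainTermCore ε x F ℓ₁ ℓ₂ u ≠ 0 := fun h0 => h (by rw [hf]; simp only; rw [h0, zero_mul])
      exact hu (mem_Icc_of_mainTermCore_ne_zero hε.le ℓ₁ ℓ₂ hne).1
  rw [hsupp, integrable_indicator_iff hKm]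
  refine IntegrableOn.of_bound hKvol hmeas.aestronglyMeasurable
    ((2 ^ n * D * max |ε| |ℓ₂|) ^ 2 * x ^ ℓ₂ * (ε ^ (n + 1))⁻¹) ?_
  rw [ae_restrict_iff' hKm]
  refine Eventually.of_forall fun u hu => ?_
  rw [Real.norm_eq_abs, hf]
  simp only
  by_cases hne : mainTermCore ε x F ℓ₁ ℓ₂ u = 0
  · rw [hne, zero_mul, abs_zero]; have := hF.nonneg; positivity
  · obtain ⟨-, hall, hsum⟩ := mem_Icc_of_mainTermCore_ne_zero hε.le ℓ₁ ℓ₂ hne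
    obtain ⟨hw0, hw⟩ := peelWeight_le hε hall
    have hc : (∀ i, ε ≤ u i) ∧ ℓ₁ < ∑ i, u i ∧ ∑ i, u i ≤ ℓ₂ := by
      rw [mainTermCore] at hne; split_ifs at hne with hc
      · exact hc
      · exact absurd rfl hne
    have hval : mainTermCore ε x F ℓ₁ ℓ₂ u = sqIter F u * x ^ (∑ i, u i) := by rw [mainTermCore, if_pos hc]
    rw [hval, abs_mul, abs_mul, abs_of_nonneg hw0, sqIter, abs_of_nonneg (sq_nonneg _),
      abs_of_nonneg (Real.rpow_nonneg (by linarith) _)]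
    have hD := hF.nonneg
    refine mul_le_mul (mul_le_mul ?_ ?_ (Real.rpow_nonneg (by linarith) _) (by positivity)) hw hw0 (by positivity)
    · rw [← sq_abs]
      refine pow_le_pow_left₀ (abs_nonneg _) ((abs_dIterV_zero_le hF u).trans ?_) 2
      refine mul_le_mul_of_nonneg_left ?_ (by positivity)
      have h1 : ε ≤ u 0 := hall 0
      have h2 : u 0 ≤ ℓ₂ := hu.2 0
      rw [abs_le]; constructor
      · have := neg_abs_le ε; linarith [le_max_left |ε| |ℓ₂|, le_abs_self ε]
      · exact h2.trans ((le_abs_self _).trans (le_max_right _ _))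
    · exact Real.rpow_le_rpow_of_exponent_le hx hsum

/-- **The main-term integral in peeling form**: for `0 < ε`, `1 ≤ x`, nice `F` and any `ℓ₁ ℓ₂`,
`∫_{ℝ^{n+1}} mainTermIntegrand = (n+1)! ∫_{ℓ₁}^{ℓ₂} x^t Mfun ε n t F dt` (when `ℓ₁ ≤ ℓ₂`). [cite: Polymath8b2014, §4.5, p. 18] -/
theorem integral_mainTermIntegrand_eq (hε : 0 < ε) (hx : 1 ≤ x) (hF : NiceFun F D) {ℓ₁ ℓ₂ : ℝ} (hℓ : ℓ₁ ≤ ℓ₂) (n : ℕ) :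
    ∫ u : Fin (n + 1) → ℝ, mainTermIntegrand ε x F ℓ₁ ℓ₂ u =
      (Nat.factorial (n + 1) : ℝ) * ∫ t in ℓ₁..ℓ₂, x ^ t * Mfun ε n t F := by
  have hint := integrable_mainTermCore_mul_peelWeight hε hx hF ℓ₁ ℓ₂ n
  simp_rw [mainTermIntegrand_eq]
  rw [integral_symmetrise (mainTermCore ε x F ℓ₁ ℓ₂) (mainTermCore_perm ℓ₁ ℓ₂)
    (fun u hu i => lt_of_lt_of_le hε ((mem_Icc_of_mainTermCore_ne_zero hε.le ℓ₁ ℓ₂ hu).2.1 i)) hint]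
  congr 1
  rw [integral_eq_integral_sliceInt n _ hint]
  have hslice : ∀ t, sliceInt n t (fun u => mainTermCore ε x F ℓ₁ ℓ₂ u * peelWeight u) =
      (Set.Ioc ℓ₁ ℓ₂).indicator (fun t => x ^ t * Mfun ε n t F) t := by
    intro t
    rw [sliceInt]
    have hpt : ∀ y : Fin n → ℝ, mainTermCore ε x F ℓ₁ ℓ₂ (Fin.snoc y (t - ∑ i, y i)) * peelWeight (Fin.snoc y (t - ∑ i, y i)) =
        (Set.Ioc ℓ₁ ℓ₂).indicator (fun t => x ^ t * roughIntegrand ε F (Fin.snoc y (t - ∑ i, y i) : Fin (n + 1) → ℝ)) t :=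
      fun y => mainTermCore_mul_peelWeight_of_sum_eq ℓ₁ ℓ₂ (sum_sliceMap n t y)
    simp_rw [hpt]
    by_cases ht : t ∈ Set.Ioc ℓ₁ ℓ₂
    · simp only [Set.indicator_of_mem ht]
      rw [MeasureTheory.integral_const_mul, ← Pfun_eq_Mfun hε n hF t, Pfun, sliceInt]
    · simp only [Set.indicator_of_notMem ht, integral_zero]
  simp_rw [hslice]
  rw [MeasureTheory.integral_indicator measurableSet_Ioc, intervalIntegral.integral_of_le hℓ]

/-- `∫_{ℓ₁}^{ℓ₂} x^t dt = (x^{ℓ₂} - x^{ℓ₁})/log x` for `x > 1`. [folklore] -/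
theorem integral_const_rpow {x : ℝ} (hx : 1 < x) (ℓ₁ ℓ₂ : ℝ) :
    ∫ t in ℓ₁..ℓ₂, x ^ t = (x ^ ℓ₂ - x ^ ℓ₁) / Real.log x := by
  have hlog : 0 < Real.log x := Real.log_pos hx
  have hd : ∀ t ∈ Set.uIcc ℓ₁ ℓ₂, HasDerivAt (fun t => x ^ t / Real.log x) (x ^ t) t := by
    intro t _
    have h := (Real.hasStrictDerivAt_const_rpow (by linarith : 0 < x) t).hasDerivAt
    exact (h.div_const (Real.log x)).congr_deriv (mul_div_cancel_right₀ _ hlog.ne')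
  rw [intervalIntegral.integral_eq_sub_of_hasDerivAt hd]
  · ring
  · exact (Real.continuous_const_rpow (by linarith)).intervalIntegrable _ _

/-- **The main-term limit estimate**: if `|M t - M 1| ≤ η` on `[ℓ₁, ℓ₂]` and `M` is continuous there
(`x > 1`, `ℓ₁ ≤ ℓ₂`), then `|∫_{ℓ₁}^{ℓ₂} x^t M(t) dt - M(1)(x^{ℓ₂} - x^{ℓ₁})/log x| ≤ η (x^{ℓ₂} - x^{ℓ₁})/log x`. [folklore] -/
theorem abs_integral_rpow_mul_sub_le {x : ℝ} (hx : 1 < x) {ℓ₁ ℓ₂ : ℝ} (hℓ : ℓ₁ ≤ ℓ₂) {M : ℝ → ℝ}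
    (hM : ContinuousOn M (Set.Icc ℓ₁ ℓ₂)) {η : ℝ} (hη : ∀ t ∈ Set.Icc ℓ₁ ℓ₂, |M t - M 1| ≤ η) :
    |(∫ t in ℓ₁..ℓ₂, x ^ t * M t) - M 1 * ((x ^ ℓ₂ - x ^ ℓ₁) / Real.log x)| ≤ η * ((x ^ ℓ₂ - x ^ ℓ₁) / Real.log x) := by
  have hx0 : 0 < x := by linarith
  have hrpow : Continuous fun t : ℝ => x ^ t := Real.continuous_const_rpow hx0.ne'
  have hi1 : IntervalIntegrable (fun t => x ^ t * M t) volume ℓ₁ ℓ₂ := by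
    refine (ContinuousOn.mul hrpow.continuousOn hM).intervalIntegrable_of_Icc hℓ
  have hi2 : IntervalIntegrable (fun t => x ^ t * M 1) volume ℓ₁ ℓ₂ := (hrpow.mul continuous_const).intervalIntegrable _ _
  rw [← integral_const_rpow hx, show M 1 * ∫ t in ℓ₁..ℓ₂, x ^ t = ∫ t in ℓ₁..ℓ₂, x ^ t * M 1 by
    rw [← intervalIntegral.integral_const_mul]; congr 1; funext t; ring,
    ← intervalIntegral.integral_sub hi1 hi2]
  have e : ∀ t, x ^ t * M t - x ^ t * M 1 = x ^ t * (M t - M 1) := fun t => by ring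
  simp_rw [e]
  calc |∫ t in ℓ₁..ℓ₂, x ^ t * (M t - M 1)| ≤ ∫ t in ℓ₁..ℓ₂, |x ^ t * (M t - M 1)| :=
        intervalIntegral.abs_integral_le_integral_abs hℓ
    _ ≤ ∫ t in ℓ₁..ℓ₂, x ^ t * η := by
        refine intervalIntegral.integral_mono_on hℓ ?_ ((hrpow.mul continuous_const).intervalIntegrable _ _) fun t ht => ?_
        · have : IntervalIntegrable (fun t => x ^ t * (M t - M 1)) volume ℓ₁ ℓ₂ := by
            have h := hi1.sub hi2
            exact h.congr fun t _ => by ring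
          exact this.abs
        · rw [abs_mul, abs_of_nonneg (Real.rpow_nonneg hx0.le _)]
          exact mul_le_mul_of_nonneg_left (hη t ht) (Real.rpow_nonneg hx0.le _)
    _ = η * ∫ t in ℓ₁..ℓ₂, x ^ t := by rw [intervalIntegral.integral_mul_const, mul_comm]

end MainTerm

end Depol

end Literature.NumberTheory.Sieve
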